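import Summits.AtomisticToContinuum.HydrodynamicLimit.Theorems.OneFlightGossipEngineCollisionActivityTailsPlaqueSplit
import Summits.AtomisticToContinuum.HydrodynamicLimit.Theorems.OneFlightGossipEngineCollisionActivityTailsCrowdedActivityMeasurable
import Summits.AtomisticToContinuum.HydrodynamicLimit.Theorems.OneFlightGossipEngineCollisionActivityTailsCfgCollisionSums
import HarnessLib

/-!
# `CollisionActivityTails` (stmt-AtomisticToContinuum-13734), line `plaque-thinning-count-ld`: measurability of the
untagged cold activity (stub `stub_uncActMeasurable`)

Helper file (`--supports stmt-AtomisticToContinuum-13734`) for the crux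
`Summit.AtomisticToContinuum.HydrodynamicLimit.Theses.OneFlightGossipEngine.CollisionActivityTails`, skeleton line
`plaque-thinning-count-ld` (`Cruxes/CollisionActivityTails/Lines/plaque_thinning_count_ld.lean`), registered stub
`stub_uncActMeasurable : UncActMeasurable` (STUB 2m, an assembly piece of `lmgf_assembly`): for every diameter `σ`,
particle number, flow `Φ`, caps `Θ, y, K`, window `τ`, start `s` and particle `i`, the untagged cold activity
`uncAct Θ y K Φ τ s i` (vocabulary file `…CollisionActivityTailsPlaqueSplit`), extended by `0` off the good set, is a
MEASURABLE function of the initial datum. Law-free.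

## The argument

`uncAct` is `(σ/τ) ·` a collision pair sum over the window `(s, s + w]` whose summand at the collision `(t, k, l)` is
`w_{kl}(Φ_t z) · |v_k(t) − v_k(t⁻)|` with the `{0,1}`-valued WEIGHT
`w_{kl}(cfg) = 𝟙{k = i} 𝟙{relSpeed cfg k l ≤ Θ} 𝟙{¬ Tagged y K cfg i}` (on the good set the recorded pre-collisional
velocity is the left limit, `IsHardSphereTrajectory.ofConfig_preVel_eq_leftLim`; `uncAct_eq_impulsePairSum`).

* §1–§2: the weight is a DOUBLE pointwise limit of continuous weights. `¬ Tagged` is the conjunction over the scales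
  `K' ≥ max K 1` of the open conditions `#{j : dist ≤ r_{K'}} < y K'` and `ballKinetic < y K'`; truncated at the scales
  `K' < L` (`scalesBelow`, `uncWeightBelow`) it is eventually (in `L`) equal to the full weight
  (`tendsto_uncWeightBelow`). At fixed `L` every factor is a limit of continuous functions of the configuration with
  ONE common rank `m`: `𝟙{relSpeed ≤ Θ} = lim ramp_m (relSpeed)` (closed condition, `tendsto_ramp` of
  `…CrowdedActivityMeasurable`), and for an upper approximation `s_m ↓ x` by continuous functions (the ramp count
  `rampCount ↓ nearCount`, the ramp kinetic energy `rampKinetic ↓ ballKinetic`) the clamps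
  `min 1 (max 0 (m (c − s_m))) → 𝟙{x < c}` (`tendsto_clamp_mul_sub`); finite products of convergent sequences converge
  (`tendsto_untagApprox`, `tendsto_uncWeightApprox`).
* §3: for a CONTINUOUS weight the weighted impulse sum, extended by `0` off the good set, is measurable by the
  configuration-aware engine `measurable_indicator_collisionPairSum_cfg_torus` (`…CfgCollisionSums`; contact on `𝕋³`
  is symmetric at every diameter, so no hypothesis on `σ`); and measurability passes to pointwise limits of the weights
  (`measurable_indicator_impulsePairSum_of_tendsto`: on the good set the collision pair sum is a FINITE sum,
  `HardSphereFlow.finite_collisionTimes_inter`, `collisionPairSum_eq_finset_sum`, so it commutes with the limit;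
  `measurable_of_tendsto_metrizable`). Two passages to the limit give `measurable_indicator_uncAct`.

References: C. Cercignani, R. Illner, M. Pulvirenti, *The Mathematical Theory of Dilute Gases* (1994), §4.2, App. 4.A
(collision sums along the hard-sphere flow, measurability in the datum); I. Gallagher, L. Saint-Raymond, B. Texier,
*From Newton to Boltzmann* (2013), §4.1 (collisions of the hard-sphere flow). Elementary; recorded here.
-/

noncomputable section

open MeasureTheory Set Filter Topology Function
open scoped ENNReal

namespace Summit.AtomisticToContinuum.HydrodynamicLimit.Theorems.CollisionActivityTailsPlaqueSplit

open Literature.MathematicalPhysics.KineticTheory Literature.Analysis.FluidPDE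
open Summit.AtomisticToContinuum.HydrodynamicLimit.Theorems.CollisionActivityTailsActivityDomination
  (Flow Cfg window act tdist nearCount)
open Summit.AtomisticToContinuum.HydrodynamicLimit.Theorems.CollisionActivityTailsCrowdedActivityMeasurable
  (ramp ramp_of_le continuous_ramp tendsto_ramp natCast_nearCount continuous_tdist_config)
open Summit.AtomisticToContinuum.HydrodynamicLimit.Theorems.CollisionActivityTailsCfgCollisionSums
  (measurable_indicator_collisionPairSum_cfg_torus)

/-! ## §1 Scalar tools: indicators of open conditions as limits of clamps, ramps -/

section Scalar

/-- **Indicator of an open condition as a limit.** If `s m → x` with `x ≤ s m` (an upper approximation), then the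
clamps `min 1 (max 0 (m · (c - s m))) → 𝟙{x < c}`: for `x < c` the argument tends to `+∞`, for `c ≤ x ≤ s m` it is
`≤ 0`. -/
theorem tendsto_clamp_mul_sub {s : ℕ → ℝ} {x : ℝ} (c : ℝ) (hs : Tendsto s atTop (𝓝 x))
    (hle : ∀ m, x ≤ s m) :
    Tendsto (fun m : ℕ => min 1 (max 0 ((m : ℝ) * (c - s m)))) atTop (𝓝 (if x < c then 1 else 0)) := by
  split_ifs with hx
  · have hδ : 0 < c - x := sub_pos.2 hx
    have h1 : ∀ᶠ m in atTop, (c - x) / 2 < c - s m :=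
      (tendsto_const_nhds.sub hs).eventually (lt_mem_nhds (by linarith))
    have h2 : ∀ᶠ m : ℕ in atTop, 2 / (c - x) ≤ (m : ℝ) :=
      (tendsto_natCast_atTop_atTop (R := ℝ)).eventually_ge_atTop _
    refine tendsto_const_nhds.congr' ?_
    filter_upwards [h1, h2] with m hm1 hm2
    refine (min_eq_left (le_max_of_le_right ?_)).symm
    calc (1 : ℝ) = 2 / (c - x) * ((c - x) / 2) := by field_simp
      _ ≤ (m : ℝ) * (c - s m) := mul_le_mul hm2 hm1.le (div_nonneg hδ.le zero_le_two) (Nat.cast_nonneg m)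
  · refine tendsto_const_nhds.congr fun m => ?_
    have hm : (m : ℝ) * (c - s m) ≤ 0 :=
      mul_nonpos_of_nonneg_of_nonpos (Nat.cast_nonneg m) (by linarith [hle m, not_lt.1 hx])
    rw [max_eq_left hm, min_eq_right zero_le_one]

/-- The ramp is nonnegative. -/
theorem ramp_nonneg (R : ℝ) (m : ℕ) (x : ℝ) : 0 ≤ ramp R m x :=
  le_min zero_le_one (le_max_left _ _)

/-- The ramp dominates the indicator of its closed condition. -/
theorem indicator_le_ramp (R : ℝ) (m : ℕ) (x : ℝ) : (if x ≤ R then (1 : ℝ) else 0) ≤ ramp R m x := by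
  split_ifs with h
  · exact (ramp_of_le m h).ge
  · exact ramp_nonneg R m x

end Scalar

/-! ## §2 Continuous approximation of the untagged weight -/

section Weight

variable {N : ℕ}

/-- The ramp count `Σ_j ramp_m (dist(x_j, x_i))`, an upper continuous approximation of `nearCount`. -/
def rampCount (r : ℝ) (i : Fin (N + 1)) (m : ℕ) (cfg : Cfg N) : ℝ :=
  ∑ j, ramp r m (tdist (cfg j).1 (cfg i).1)

/-- The ramp kinetic energy `Σ_j ramp_m (dist(x_j, x_i)) |v_j|²`, an upper continuous approximation of
`ballKinetic`. -/
def rampKinetic (r : ℝ) (i : Fin (N + 1)) (m : ℕ) (cfg : Cfg N) : ℝ :=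
  ∑ j, ramp r m (tdist (cfg j).1 (cfg i).1) * ‖(cfg j).2‖ ^ 2

/-- The ramp count is continuous. -/
theorem continuous_rampCount (r : ℝ) (i : Fin (N + 1)) (m : ℕ) : Continuous (rampCount r i m) :=
  continuous_finsetSum _ fun j _ => (continuous_ramp r m).comp (continuous_tdist_config j i)

/-- The ramp kinetic energy is continuous. -/
theorem continuous_rampKinetic (r : ℝ) (i : Fin (N + 1)) (m : ℕ) : Continuous (rampKinetic r i m) :=
  continuous_finsetSum _ fun j _ => ((continuous_ramp r m).comp (continuous_tdist_config j i)).mul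
    (((continuous_apply j).snd.norm).pow 2)

/-- The ramp counts converge to `nearCount`. -/
theorem tendsto_rampCount (r : ℝ) (i : Fin (N + 1)) (cfg : Cfg N) :
    Tendsto (fun m => rampCount r i m cfg) atTop (𝓝 (nearCount cfg i r : ℝ)) := by
  rw [natCast_nearCount]
  exact tendsto_finsetSum _ fun j _ => tendsto_ramp r _

/-- The ramp counts dominate `nearCount`. -/
theorem natCast_nearCount_le_rampCount (r : ℝ) (i : Fin (N + 1)) (cfg : Cfg N) (m : ℕ) :
    (nearCount cfg i r : ℝ) ≤ rampCount r i m cfg := by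
  rw [natCast_nearCount]
  exact Finset.sum_le_sum fun j _ => indicator_le_ramp r m _

/-- The ramp kinetic energies converge to `ballKinetic`. -/
theorem tendsto_rampKinetic (r : ℝ) (i : Fin (N + 1)) (cfg : Cfg N) :
    Tendsto (fun m => rampKinetic r i m cfg) atTop (𝓝 (ballKinetic cfg i r)) := by
  unfold ballKinetic rampKinetic
  refine tendsto_finsetSum _ fun j _ => ?_
  rw [← boole_mul]
  exact (tendsto_ramp r _).mul_const _

/-- The ramp kinetic energies dominate `ballKinetic`. -/
theorem ballKinetic_le_rampKinetic (r : ℝ) (i : Fin (N + 1)) (cfg : Cfg N) (m : ℕ) :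
    ballKinetic cfg i r ≤ rampKinetic r i m cfg := by
  unfold ballKinetic rampKinetic
  refine Finset.sum_le_sum fun j _ => ?_
  rw [← boole_mul]
  exact mul_le_mul_of_nonneg_right (indicator_le_ramp r m _) (sq_nonneg _)

/-- The tagging scales `K'` below the truncation `L`: `K ≤ K'`, `1 ≤ K'`, `K' < L`. -/
def scalesBelow (K L : ℕ) : Finset ℕ := (Finset.range L).filter fun K' => K ≤ K' ∧ 1 ≤ K'

/-- The rank-`m` continuous approximation of the indicator of "`i` is untagged at every scale below `L`": the product
over the scales `K' < L` of the clamps `min 1 (max 0 ·)` of `m (y K' − rampCount)` and of `m (y K' − rampKinetic)`. -/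
def untagApprox (y : ℝ) (K L : ℕ) (i : Fin (N + 1)) (m : ℕ) (cfg : Cfg N) : ℝ :=
  ∏ K' ∈ scalesBelow K L,
    (min 1 (max 0 ((m : ℝ) * (y * K' - rampCount (scaleRadius N K') i m cfg))) *
      min 1 (max 0 ((m : ℝ) * (y * K' - rampKinetic (scaleRadius N K') i m cfg))))

/-- The approximants of the untagged indicator are continuous. -/
theorem continuous_untagApprox (y : ℝ) (K L : ℕ) (i : Fin (N + 1)) (m : ℕ) :
    Continuous (untagApprox y K L i m) := by
  unfold untagApprox
  refine continuous_finsetProd _ fun K' _ => ?_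
  exact (continuous_const.min (continuous_const.max (continuous_const.mul (continuous_const.sub
    (continuous_rampCount _ i m))))).mul (continuous_const.min (continuous_const.max
      (continuous_const.mul (continuous_const.sub (continuous_rampKinetic _ i m)))))

/-- **The approximants converge to the truncated untagged indicator**
`𝟙{∀ K' < L scale: nearCount < y K' ∧ ballKinetic < y K'}`. -/
theorem tendsto_untagApprox (y : ℝ) (K L : ℕ) (i : Fin (N + 1)) (cfg : Cfg N) :
    Tendsto (fun m => untagApprox y K L i m cfg) atTop
      (𝓝 (if ∀ K' ∈ scalesBelow K L, (nearCount cfg i (scaleRadius N K') : ℝ) < y * K' ∧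
          ballKinetic cfg i (scaleRadius N K') < y * K' then 1 else 0)) := by
  have h : ∀ K' ∈ scalesBelow K L, Tendsto (fun m : ℕ =>
      min 1 (max 0 ((m : ℝ) * (y * K' - rampCount (scaleRadius N K') i m cfg))) *
        min 1 (max 0 ((m : ℝ) * (y * K' - rampKinetic (scaleRadius N K') i m cfg)))) atTop
      (𝓝 (if (nearCount cfg i (scaleRadius N K') : ℝ) < y * K' ∧
          ballKinetic cfg i (scaleRadius N K') < y * K' then 1 else 0)) := by
    intro K' _
    have h1 := tendsto_clamp_mul_sub (y * K') (tendsto_rampCount (scaleRadius N K') i cfg)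
      (natCast_nearCount_le_rampCount _ i cfg)
    have h2 := tendsto_clamp_mul_sub (y * K') (tendsto_rampKinetic (scaleRadius N K') i cfg)
      (ballKinetic_le_rampKinetic _ i cfg)
    convert h1.mul h2 using 2
    rw [ite_zero_mul_ite_zero, one_mul]
  unfold untagApprox
  convert tendsto_finsetProd _ h using 2
  rw [Finset.prod_boole]

/-- The relative speed of a pair is a continuous function of the configuration. -/
theorem continuous_relSpeed_config (k l : Fin (N + 1)) : Continuous fun cfg : Cfg N => relSpeed cfg k l := by
  unfold relSpeed
  exact ((continuous_apply k).snd.sub (continuous_apply l).snd).norm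

open scoped Classical in
/-- The **untagged cold weight** of the ordered pair `(k, l)`: `𝟙{k = i} 𝟙{relSpeed ≤ Θ} 𝟙{¬ Tagged y K cfg i}`
(the indicator inside `uncAct`). -/
def uncWeight (Θ y : ℝ) (K : ℕ) (i k l : Fin (N + 1)) (cfg : Cfg N) : ℝ :=
  if k = i ∧ relSpeed cfg k l ≤ Θ ∧ ¬ Tagged y K cfg i then 1 else 0

/-- The untagged cold weight with the tagging truncated at the scales below `L`. -/
def uncWeightBelow (Θ y : ℝ) (K L : ℕ) (i k l : Fin (N + 1)) (cfg : Cfg N) : ℝ :=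
  if k = i ∧ relSpeed cfg k l ≤ Θ ∧ ∀ K' ∈ scalesBelow K L, (nearCount cfg i (scaleRadius N K') : ℝ) < y * K' ∧
    ballKinetic cfg i (scaleRadius N K') < y * K' then 1 else 0

/-- The rank-`m` CONTINUOUS approximation of the truncated weight: `𝟙{k = i} · ramp_m (relSpeed) · untagApprox`. -/
def uncWeightApprox (Θ y : ℝ) (K L : ℕ) (i : Fin (N + 1)) (m : ℕ) (k l : Fin (N + 1)) (cfg : Cfg N) : ℝ :=
  (if k = i then 1 else 0) * ramp Θ m (relSpeed cfg k l) * untagApprox y K L i m cfg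

/-- The approximating weights are continuous. -/
theorem continuous_uncWeightApprox (Θ y : ℝ) (K L : ℕ) (i : Fin (N + 1)) (m : ℕ) (k l : Fin (N + 1)) :
    Continuous (uncWeightApprox Θ y K L i m k l) :=
  (continuous_const.mul ((continuous_ramp Θ m).comp (continuous_relSpeed_config k l))).mul
    (continuous_untagApprox y K L i m)

/-- **First limit (`m → ∞`, `L` fixed):** the continuous weights converge to the truncated weight. -/
theorem tendsto_uncWeightApprox (Θ y : ℝ) (K L : ℕ) (i k l : Fin (N + 1)) (cfg : Cfg N) :
    Tendsto (fun m => uncWeightApprox Θ y K L i m k l cfg) atTop (𝓝 (uncWeightBelow Θ y K L i k l cfg)) := by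
  have h := ((tendsto_const_nhds (x := if k = i then (1 : ℝ) else 0)).mul
    (tendsto_ramp Θ (relSpeed cfg k l))).mul (tendsto_untagApprox y K L i cfg)
  unfold uncWeightApprox uncWeightBelow
  convert h using 2
  rw [ite_zero_mul_ite_zero, ite_zero_mul_ite_zero, mul_one, mul_one]
  simp only [and_assoc]

/-- **Second limit (`L → ∞`):** the truncated weights are eventually equal to the untagged cold weight (a tagged
particle is tagged at some scale `K'`, hence below every `L > K'`; an untagged one is untagged below every `L`). -/
theorem tendsto_uncWeightBelow (Θ y : ℝ) (K : ℕ) (i k l : Fin (N + 1)) (cfg : Cfg N) :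
    Tendsto (fun L => uncWeightBelow Θ y K L i k l cfg) atTop (𝓝 (uncWeight Θ y K i k l cfg)) := by
  unfold uncWeightBelow uncWeight
  by_cases ht : Tagged y K cfg i
  · have ht' := ht
    obtain ⟨K', hKK', h1K', hor⟩ := ht'
    refine tendsto_const_nhds.congr' ?_
    filter_upwards [eventually_gt_atTop K'] with L hL
    have hK' : K' ∈ scalesBelow K L := Finset.mem_filter.2 ⟨Finset.mem_range.2 hL, hKK', h1K'⟩
    rw [if_neg fun h => h.2.2 ht, if_neg fun h => ?_]
    rcases hor with hle | hle
    · exact (not_le.2 (h.2.2 K' hK').1) hle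
    · exact (not_le.2 (h.2.2 K' hK').2) hle
  · have hall : ∀ L, ∀ K' ∈ scalesBelow K L, (nearCount cfg i (scaleRadius N K') : ℝ) < y * K' ∧
        ballKinetic cfg i (scaleRadius N K') < y * K' := by
      intro L K' hK'
      by_contra hcon
      refine ht ⟨K', (Finset.mem_filter.1 hK').2.1, (Finset.mem_filter.1 hK').2.2, ?_⟩
      rcases not_and_or.1 hcon with hc | hk
      · exact Or.inl (not_lt.1 hc)
      · exact Or.inr (not_lt.1 hk)
    refine tendsto_const_nhds.congr fun L => ?_
    by_cases hkr : k = i ∧ relSpeed cfg k l ≤ Θ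
    · rw [if_pos ⟨hkr.1, hkr.2, ht⟩, if_pos ⟨hkr.1, hkr.2, hall L⟩]
    · rw [if_neg fun h => hkr ⟨h.1, h.2.1⟩, if_neg fun h => hkr ⟨h.1, h.2.1⟩]

end Weight

/-! ## §3 Weighted impulse sums along the flow: the engine and the passage to the limit -/

section FlowSums

variable {σ : ℝ} {N : ℕ}

/-- The **weighted impulse pair sum** of the orbit of `z` over `(a, b]`: the collision pair sum of
`W k l (Φ_t z) · |v_k(t) − v_k(t⁻)|` (weight read off the post-collisional configuration, pre-collisional velocity
the left limit). -/
def impulsePairSum (Φ : Flow σ N) (a b : ℝ) (W : Fin (N + 1) → Fin (N + 1) → Cfg N → ℝ) (z : Cfg N) : ℝ :=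
  collisionPairSum (Torus.geometry (Fin 3)) (hsDiameter σ N) (fun t => Φ.flow t z) (Ioc a b)
    fun t k l => W k l (Φ.flow t z) * ‖(Φ.flow t z k).2 - (leftLim (fun t' => Φ.flow t' z) t k).2‖

/-- **The engine, continuous weights.** For a continuous weight the weighted impulse pair sum, extended by `0` off the
good set, is measurable in the datum (`measurable_indicator_collisionPairSum_cfg_torus`). -/
theorem measurable_indicator_impulsePairSum_of_continuous (Φ : Flow σ N) (a b : ℝ)
    {W : Fin (N + 1) → Fin (N + 1) → Cfg N → ℝ} (hW : ∀ k l, Continuous (W k l)) :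
    Measurable (Φ.good.indicator (impulsePairSum Φ a b W)) := by
  have hv : ∀ k : Fin (N + 1), Continuous fun cfg : Cfg N => (cfg k).2 := fun k => (continuous_apply k).snd
  have hvm : ∀ k : Fin (N + 1), Measurable fun cfg : Cfg N => (cfg k).2 := fun k => (measurable_pi_apply k).snd
  have hHc : ∀ k l, Continuous fun p : ℝ × Cfg N × Cfg N => W k l p.2.1 * ‖(p.2.1 k).2 - (p.2.2 k).2‖ :=
    fun k l => ((hW k l).comp continuous_snd.fst).mul
      (((hv k).comp continuous_snd.fst).sub ((hv k).comp continuous_snd.snd)).norm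
  have hHm : ∀ k l, Measurable fun p : ℝ × Cfg N × Cfg N => W k l p.2.1 * ‖(p.2.1 k).2 - (p.2.2 k).2‖ :=
    fun k l => ((hW k l).measurable.comp measurable_snd.fst).mul
      (((hvm k).comp measurable_snd.fst).sub ((hvm k).comp measurable_snd.snd)).norm
  exact measurable_indicator_collisionPairSum_cfg_torus Φ
    (H := fun k l p => W k l p.2.1 * ‖(p.2.1 k).2 - (p.2.2 k).2‖) hHc hHm a b

/-- **Passage to the limit in the weight.** If the weights `W m` converge pointwise to `W'` and every weighted impulse
pair sum with weight `W m`, extended by `0` off the good set, is measurable, so is the one with weight `W'`: on the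
good set the collision pair sum is a finite sum (`HardSphereFlow.finite_collisionTimes_inter`), so it converges, and a
pointwise limit of measurable functions is measurable. -/
theorem measurable_indicator_impulsePairSum_of_tendsto (Φ : Flow σ N) (a b : ℝ)
    {W : ℕ → Fin (N + 1) → Fin (N + 1) → Cfg N → ℝ} {W' : Fin (N + 1) → Fin (N + 1) → Cfg N → ℝ}
    (hlim : ∀ k l cfg, Tendsto (fun m => W m k l cfg) atTop (𝓝 (W' k l cfg)))
    (hmeas : ∀ m, Measurable (Φ.good.indicator (impulsePairSum Φ a b (W m)))) :
    Measurable (Φ.good.indicator (impulsePairSum Φ a b W')) := by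
  refine measurable_of_tendsto_metrizable hmeas ?_
  rw [tendsto_pi_nhds]
  intro z
  by_cases hz : z ∈ Φ.good
  · simp only [indicator_of_mem hz]
    have hfin : (collisionTimes (Torus.geometry (Fin 3)) (hsDiameter σ N) (fun t => Φ.flow t z) ∩
        Ioc a b).Finite := Φ.finite_collisionTimes_inter hz Ioc_subset_Icc_self
    unfold impulsePairSum
    simp only [collisionPairSum_eq_finset_sum hfin]
    exact tendsto_finsetSum _ fun t _ => tendsto_finsetSum _ fun p _ => (hlim p.1 p.2 _).mul_const _
  · simp only [indicator_of_notMem hz]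
    exact tendsto_const_nhds

/-- **The untagged cold weight is admissible:** the weighted impulse pair sum with weight `uncWeight Θ y K i`, extended
by `0` off the good set, is measurable (engine on the continuous approximants, then the two limits `m → ∞`, `L → ∞`). -/
theorem measurable_indicator_impulsePairSum_uncWeight (Φ : Flow σ N) (a b Θ y : ℝ) (K : ℕ) (i : Fin (N + 1)) :
    Measurable (Φ.good.indicator (impulsePairSum Φ a b (uncWeight Θ y K i))) :=
  measurable_indicator_impulsePairSum_of_tendsto Φ a b (W := fun L => uncWeightBelow Θ y K L i)
    (fun k l cfg => tendsto_uncWeightBelow Θ y K i k l cfg) fun L =>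
      measurable_indicator_impulsePairSum_of_tendsto Φ a b (W := fun m => uncWeightApprox Θ y K L i m)
        (fun k l cfg => tendsto_uncWeightApprox Θ y K L i k l cfg) fun m =>
          measurable_indicator_impulsePairSum_of_continuous Φ a b fun k l =>
            continuous_uncWeightApprox Θ y K L i m k l

/-- **`uncAct` as a weighted impulse pair sum.** On the good set,
`uncAct Θ y K Φ τ s i z = (σ/τ) · impulsePairSum Φ s (s + w) (uncWeight Θ y K i) z`: both are finite sums over the
collisions of the orbit in the window, and the recorded pre-collisional velocity of `imp` is the left limit
(`IsHardSphereTrajectory.ofConfig_preVel_eq_leftLim`). -/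
theorem uncAct_eq_impulsePairSum (Θ y : ℝ) (K : ℕ) (Φ : Flow σ N) (τ s : ℝ) (i : Fin (N + 1)) {z : Cfg N}
    (hz : z ∈ Φ.good) :
    uncAct Θ y K Φ τ s i z = σ / τ * impulsePairSum Φ s (s + window τ N) (uncWeight Θ y K i) z := by
  have hγ := Φ.isTrajectory z hz
  have hfin : (collisionTimes (Torus.geometry (Fin 3)) (hsDiameter σ N) (fun t => Φ.flow t z) ∩
      Ioc s (s + window τ N)).Finite := Φ.finite_collisionTimes_inter hz Ioc_subset_Icc_self
  unfold uncAct HardSphereFlow.collisionPairSum impulsePairSum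
  congr 1
  simp only [collisionPairSum_eq_finset_sum hfin]
  refine Finset.sum_congr rfl fun t _ => Finset.sum_congr rfl fun p hp => ?_
  obtain ⟨k, l⟩ := p
  dsimp only
  unfold imp rec
  rw [hγ.ofConfig_preVel_eq_leftLim hp]
  simp only [HardSphereCollisionRecord.ofConfig_postVel]
  unfold uncWeight
  split_ifs <;> simp

/-- **Measurability of the untagged cold activity in the initial datum.** For every flow, caps, window, start and
particle, `uncAct Θ y K Φ τ s i`, extended by `0` off the good set, is measurable. -/
theorem measurable_indicator_uncAct (Φ : Flow σ N) (Θ y : ℝ) (K : ℕ) (τ s : ℝ) (i : Fin (N + 1)) :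
    Measurable (Φ.good.indicator fun z => uncAct Θ y K Φ τ s i z) := by
  have h : Φ.good.indicator (fun z => uncAct Θ y K Φ τ s i z) =
      fun z => σ / τ * Φ.good.indicator (impulsePairSum Φ s (s + window τ N) (uncWeight Θ y K i)) z := by
    funext z
    by_cases hz : z ∈ Φ.good
    · rw [indicator_of_mem hz, indicator_of_mem hz, uncAct_eq_impulsePairSum Θ y K Φ τ s i hz]
    · rw [indicator_of_notMem hz, indicator_of_notMem hz, mul_zero]
  rw [h]
  exact (measurable_indicator_impulsePairSum_uncWeight Φ s _ Θ y K i).const_mul _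

end FlowSums

/-! ## §4 The registered statement -/

/-- **UNTAGGED COLD ACTIVITY MEASURABILITY** (statement of STUB 2m of the line `plaque-thinning-count-ld`, verbatim from
the skeleton): law-free — for every diameter, particle number, flow, caps `Θ, y, K`, window `τ`, start `s` and particle
`i`, the untagged cold activity, extended by `0` off the good set, is measurable in the initial datum. -/
def UncActMeasurable : Prop :=
  ∀ (σ : ℝ) (N : ℕ) (Φ : Flow σ N) (Θ y : ℝ) (K : ℕ) (τ s : ℝ) (i : Fin (N + 1)),
    Measurable (Φ.good.indicator fun z => uncAct Θ y K Φ τ s i z)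

/-- **STUB 2m (line `plaque-thinning-count-ld`).** The untagged cold activity, extended by `0` off the good set, is
measurable in the initial datum, for all data (`measurable_indicator_uncAct`). -/
theorem stub_uncActMeasurable : UncActMeasurable :=
  fun _ _ Φ Θ y K τ s i => measurable_indicator_uncAct Φ Θ y K τ s i

end Summit.AtomisticToContinuum.HydrodynamicLimit.Theorems.CollisionActivityTailsPlaqueSplit

end
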